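import Mathlib.Analysis.Calculus.ParametricIntegral
import Mathlib.MeasureTheory.Integral.Bochner.Basic
import HarnessLib

/-!
# Stub `stub_diffIdentity` of line `Sketch` (crux `stmt-QuantumFields-8760`)

Route `EquipartitionCriticality` of `YangMills`, crux item `stmt-QuantumFields-8760`
(`Summit.QuantumFields.YangMills.Theses.EquipartitionCriticality.EquipartitionPinsProbe`), line
`Sketch`, stub `stub_diffIdentity`.

What is proved: an abstract differentiation-under-the-integral identity. On a finite measure
space `(Ω, μ)`, let `A B : ℝ → Ω → ℝ` be two one-parameter families of measurable functions,
uniformly bounded by `K`, `K`-Lipschitz in the parameter for every `ω`, differentiable in the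
parameter at `0` with (measurable) derivatives `a`, `b`, and with equal integrals
`∫ A t ∂μ = ∫ B t ∂μ` for every `t`. Then `∫ a ∂μ = ∫ b ∂μ`.

Proof: Mathlib's `hasDerivAt_integral_of_dominated_loc_of_lip` (neighbourhood `Set.univ`,
constant integrable Lipschitz bound `K`, integrability of `A 0` from the uniform bound on a finite
measure) gives `HasDerivAt (t ↦ ∫ A t ∂μ) (∫ a ∂μ) 0` and likewise for `B`; the two functions of
`t` coincide by hypothesis, so the derivatives agree by `HasDerivAt.unique`. This is the analytic
step used to differentiate the skew Haar-shift identity of torus-limit states at parameter `0`.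
-/

noncomputable section

open MeasureTheory

namespace Summit.QuantumFields.YangMills.Theorems.EquipartitionPinsProbe

namespace TangentDiffIdentity

/-- **Differentiation under the integral sign, bounded Lipschitz family on a finite measure.**
If `A : ℝ → Ω → ℝ` is measurable in `ω` for each `t`, uniformly bounded by `K`, `K`-Lipschitz in
`t` for every `ω`, and `t ↦ A t ω` has derivative `a ω` at `0` for every `ω` with `a` measurable,
then `t ↦ ∫ A t ∂μ` has derivative `∫ a ∂μ` at `0` (from
`hasDerivAt_integral_of_dominated_loc_of_lip` with the constant bound `K` on `Set.univ`). -/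
theorem hasDerivAt_integral_of_bounded_lipschitz {Ω : Type} [MeasurableSpace Ω] (μ : Measure Ω)
    [IsFiniteMeasure μ] (A : ℝ → Ω → ℝ) (a : Ω → ℝ) (K : ℝ) (hAm : ∀ t, Measurable (A t))
    (ham : Measurable a) (hAbd : ∀ t ω, |A t ω| ≤ K)
    (hAlip : ∀ ω t s, |A t ω - A s ω| ≤ K * |t - s|)
    (hAd : ∀ ω, HasDerivAt (fun t => A t ω) (a ω) 0) :
    HasDerivAt (fun t => ∫ ω, A t ω ∂μ) (∫ ω, a ω ∂μ) 0 := by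
  have hlip : ∀ᵐ ω ∂μ, LipschitzOnWith (Real.nnabs ((fun _ : Ω => K) ω)) (fun t => A t ω)
      Set.univ := by
    refine ae_of_all _ fun ω => LipschitzOnWith.of_dist_le_mul fun t _ s _ => ?_
    rw [Real.dist_eq, Real.dist_eq, Real.coe_nnabs]
    exact (hAlip ω t s).trans (mul_le_mul_of_nonneg_right (le_abs_self K) (abs_nonneg _))
  exact (hasDerivAt_integral_of_dominated_loc_of_lip (μ := μ) (F := A) (x₀ := (0 : ℝ))
    (s := Set.univ) (bound := fun _ => K) (F' := a) Filter.univ_mem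
    (Filter.Eventually.of_forall fun t => (hAm t).aestronglyMeasurable)
    (Integrable.of_bound (hAm 0).aestronglyMeasurable K
      (ae_of_all _ fun ω => by simpa only [Real.norm_eq_abs] using hAbd 0 ω))
    ham.aestronglyMeasurable hlip (integrable_const K) (ae_of_all _ hAd)).2

end TangentDiffIdentity

/-- STUB `stub_diffIdentity` — **equal parametric integrals have equal derivative integrals.**
On a finite measure space, for two families `A B : ℝ → Ω → ℝ` measurable in `ω`, uniformly
bounded by `K`, `K`-Lipschitz in the parameter, differentiable at `0` with measurable derivatives
`a`, `b`, and with `∫ A t ∂μ = ∫ B t ∂μ` for all `t`: `∫ a ∂μ = ∫ b ∂μ` (differentiate under the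
integral sign on both sides and use uniqueness of the derivative). -/
theorem stub_diffIdentity :
    ∀ (Ω : Type) [MeasurableSpace Ω] (μ : MeasureTheory.Measure Ω), MeasureTheory.IsFiniteMeasure μ →
      ∀ (A B : ℝ → Ω → ℝ) (a b : Ω → ℝ) (K : ℝ),
        (∀ t, Measurable (A t)) → (∀ t, Measurable (B t)) → Measurable a → Measurable b →
        (∀ t ω, |A t ω| ≤ K) → (∀ t ω, |B t ω| ≤ K) →
        (∀ ω t s, |A t ω - A s ω| ≤ K * |t - s|) → (∀ ω t s, |B t ω - B s ω| ≤ K * |t - s|) →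
        (∀ ω, HasDerivAt (fun t => A t ω) (a ω) 0) → (∀ ω, HasDerivAt (fun t => B t ω) (b ω) 0) →
        (∀ t, ∫ ω, A t ω ∂μ = ∫ ω, B t ω ∂μ) →
        ∫ ω, a ω ∂μ = ∫ ω, b ω ∂μ := by
  intro Ω _ μ hμ A B a b K hAm hBm ham hbm hAbd hBbd hAlip hBlip hAd hBd hAB
  have hA := TangentDiffIdentity.hasDerivAt_integral_of_bounded_lipschitz μ A a K hAm ham hAbd
    hAlip hAd
  have hB := TangentDiffIdentity.hasDerivAt_integral_of_bounded_lipschitz μ B b K hBm hbm hBbd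
    hBlip hBd
  have hfun : (fun t => ∫ ω, A t ω ∂μ) = fun t => ∫ ω, B t ω ∂μ := funext hAB
  rw [hfun] at hA
  exact hA.unique hB

end Summit.QuantumFields.YangMills.Theorems.EquipartitionPinsProbe

end
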